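import Summits.AtomisticToContinuum.Crystallization.Theorems.ThreeConeCertificateSlackRigidityPricedFloorsDefs
import Summits.AtomisticToContinuum.Crystallization.Theorems.PhononSlackCertificatesPeriodicGivenLayeredExtraction2
import Summits.AtomisticToContinuum.Crystallization.Theorems.ChessboardParticlePlanesPeriodicWindowsShapeStationarity1

/-!
# `SlackRigidity` (stmt-AtomisticToContinuum-11960), line `priced-floors-palm-exactification`:
# exactification of a layered neighbourhood (stub `stub_exactify`)

If a point `y` of a `δ`-separated configuration `S ⊆ ℝ³` is `η`-layered (two-way `η`-matched with an
admissible layered set, `S`-side radius `2`, pattern-side radius `19/10`) for EVERY `η > 0`, then it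
is exactly layered (`ExactLayeredAt S y`).  Proof: (1) reduce to `y = 0` (`layeredAt_image_sub_iff`)
and NORMALISE the data of each matching by re-indexing layers and in-plane indices at the pattern
point matched with `0` (`reindex`, `ext_haggLabel_shift`), so that `z 0 = 0` and the translation has
norm `≤ η` (`exists_normalised`); (2) COMPACTNESS: the normalised data at tolerances `1/(n+1)` live
in the compact first-countable data space `Isom(ℝ³) × {admissible (a, s, z), z 0 = 0}`
(`isCompact_data`: `ext_isCompact_isometries`, `ext_isCompact_words`, Tychonoff) — extract a
convergent subsequence, whose limit data are admissible; (3) EXACTNESS by local finiteness: pattern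
points of norm `≤ 4` have indices in a fixed finite set (`index_bound`, via `ext_layer_bound` and
lattice coordinates), the words eventually agree with the limit word on these layers
(`eventually_labels`), the pattern points with fixed indices converge (`tendsto_point`), and a limit
of points approaching a separated set lies in it (`mem_of_separated`).

No definitions.  All `[folklore]`.
-/

noncomputable section

open Filter Set Topology

namespace Summit.AtomisticToContinuum.Crystallization.Theorems.SlackRigidityPricedFloorsExactify

open Literature.MathematicalPhysics.StatisticalMechanics
open Summit.AtomisticToContinuum.Crystallization.Theorems.SlackRigidityPricedFloors
open Summit.AtomisticToContinuum.Crystallization.Theorems.LayeredHull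

/-- The lattice vectors `u(a), v(a), w(a)` depend continuously on the spacing `a` (they are
`a • u(1)`, `a • v(1)`, `a • w(1)`). [folklore] -/
theorem continuous_vecs : Continuous (fun a : ℝ => (triangularVec₁ a : E3)) ∧
    Continuous (fun a : ℝ => (triangularVec₂ a : E3)) ∧
    Continuous (fun a : ℝ => (barlowOffset a : E3)) := by
  have h1 : (fun a : ℝ => (triangularVec₁ a : E3)) = fun a => a • triangularVec₁ 1 := by
    funext a; ext k; fin_cases k <;> simp [triangularVec₁]
  have h2 : (fun a : ℝ => (triangularVec₂ a : E3)) = fun a => a • triangularVec₂ 1 := by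
    funext a; ext k; fin_cases k <;> simp [triangularVec₂] <;> ring
  have h3 : (fun a : ℝ => (barlowOffset a : E3)) = fun a => a • barlowOffset 1 := by
    funext a; ext k; fin_cases k <;> simp [barlowOffset] <;> ring
  rw [h1, h2, h3]
  exact ⟨continuous_id.smul continuous_const, continuous_id.smul continuous_const,
    continuous_id.smul continuous_const⟩

/-- **The pattern point with fixed indices depends continuously on the data.** Along data
`(A_k, a_k, s_k, z_k) → (T₀, a₀, s₀, z₀)` (operator norm, reals, pointwise), the pattern point with
in-plane indices `(i, j)`, label `L` and layer `m` converges to the limit pattern point.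
[folklore] -/
theorem tendsto_point {A : ℕ → E3 →ₗᵢ[ℝ] E3} {a : ℕ → ℝ} {s : ℕ → ℤ → ℤ} {z : ℕ → ℤ → ℝ}
    {T₀ : E3 →L[ℝ] E3} {a₀ : ℝ} {s₀ : ℤ → ℤ} {z₀ : ℤ → ℝ}
    (h : Tendsto (fun k => ((A k).toContinuousLinearMap, a k, s k, z k)) atTop
      (𝓝 ((T₀, a₀, s₀, z₀) : (E3 →L[ℝ] E3) × ℝ × (ℤ → ℤ) × (ℤ → ℝ)))) (m i j : ℤ) (L : ℝ) :
    Tendsto (fun k => A k (((i : ℝ) • triangularVec₁ (a k)) + ((j : ℝ) • triangularVec₂ (a k)) +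
        (L • barlowOffset (a k)) + (z k m • layerNormal 1))) atTop
      (𝓝 (T₀ (((i : ℝ) • triangularVec₁ a₀) + ((j : ℝ) • triangularVec₂ a₀) +
        (L • barlowOffset a₀) + (z₀ m • layerNormal 1)))) := by
  obtain ⟨hu, hv, hw⟩ := continuous_vecs
  have ha : Continuous fun e : (E3 →L[ℝ] E3) × ℝ × (ℤ → ℤ) × (ℤ → ℝ) => e.2.1 :=
    continuous_fst.comp continuous_snd
  have hz : Continuous fun e : (E3 →L[ℝ] E3) × ℝ × (ℤ → ℤ) × (ℤ → ℝ) => e.2.2.2 m :=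
    (continuous_apply m).comp (continuous_snd.comp (continuous_snd.comp continuous_snd))
  have h1 : Continuous fun e : (E3 →L[ℝ] E3) × ℝ × (ℤ → ℤ) × (ℤ → ℝ) =>
      ((i : ℝ) • triangularVec₁ e.2.1 : E3) := (hu.comp ha).const_smul (i : ℝ)
  have h2 : Continuous fun e : (E3 →L[ℝ] E3) × ℝ × (ℤ → ℤ) × (ℤ → ℝ) =>
      ((j : ℝ) • triangularVec₂ e.2.1 : E3) := (hv.comp ha).const_smul (j : ℝ)
  have h3 : Continuous fun e : (E3 →L[ℝ] E3) × ℝ × (ℤ → ℤ) × (ℤ → ℝ) =>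
      (L • barlowOffset e.2.1 : E3) := (hw.comp ha).const_smul L
  have h4 : Continuous fun e : (E3 →L[ℝ] E3) × ℝ × (ℤ → ℤ) × (ℤ → ℝ) =>
      (e.2.2.2 m • layerNormal 1 : E3) := hz.smul continuous_const
  have hc : Continuous fun e : (E3 →L[ℝ] E3) × ℝ × (ℤ → ℤ) × (ℤ → ℝ) =>
      e.1 (((i : ℝ) • triangularVec₁ e.2.1) + ((j : ℝ) • triangularVec₂ e.2.1) +
        (L • barlowOffset e.2.1) + (e.2.2.2 m • layerNormal 1)) :=
    continuous_fst.clm_apply (((h1.add h2).add h3).add h4)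
  exact (hc.tendsto _).comp h

/-- Along converging data the Hägg words eventually agree with the limit word on any finite window
of layers, hence so do the labels (`ext_haggLabel_eq_of_eqOn`). [folklore] -/
theorem eventually_labels {A : ℕ → E3 →ₗᵢ[ℝ] E3} {a : ℕ → ℝ} {s : ℕ → ℤ → ℤ} {z : ℕ → ℤ → ℝ}
    {T₀ : E3 →L[ℝ] E3} {a₀ : ℝ} {s₀ : ℤ → ℤ} {z₀ : ℤ → ℝ}
    (h : Tendsto (fun k => ((A k).toContinuousLinearMap, a k, s k, z k)) atTop
      (𝓝 ((T₀, a₀, s₀, z₀) : (E3 →L[ℝ] E3) × ℝ × (ℤ → ℤ) × (ℤ → ℝ)))) (M : ℕ) :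
    ∀ᶠ k in atTop, ∀ m : ℤ, |m| ≤ M → haggLabel (s k) m = haggLabel s₀ m := by
  have hs : Tendsto (fun k => s k) atTop (𝓝 s₀) :=
    ((continuous_fst.comp (continuous_snd.comp continuous_snd)).tendsto
      ((T₀, a₀, s₀, z₀) : (E3 →L[ℝ] E3) × ℝ × (ℤ → ℤ) × (ℤ → ℝ))).comp h
  have hev : ∀ᶠ k in atTop, ∀ m ∈ Finset.Icc (-(M : ℤ)) M, s k m = s₀ m := by
    refine (eventually_all_finset _).2 fun m _ => ?_
    exact (tendsto_pi_nhds.1 hs m).eventually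
      (show ∀ᶠ y in 𝓝 (s₀ m), y = s₀ m by simp [nhds_discrete])
  refine hev.mono fun k hk m hm => ext_haggLabel_eq_of_eqOn (M := M) (fun n hn => ?_) m hm
  exact hk n (Finset.mem_Icc.2 (abs_le.1 hn))

/-- **Finitely many indices in a ball.** For admissible data with `z 0 = 0`, a pattern point of
norm `≤ 4` has layer index and in-plane indices of size `≤ 16` (the height of the point is `z m`,
`ext_layer_bound`; its first two coordinates are `a (i + j/2 + L/2)` and `a √3 (j/2 + L/6)` with
`|L| ≤ |m|`, `shp_abs_haggLabel_sub_le`). [folklore] -/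
theorem index_bound {a : ℝ} {s : ℤ → ℤ} {z : ℤ → ℝ} (hadm : IsAdmissibleLayering a s z)
    (hz0 : z 0 = 0) (A : E3 →ₗᵢ[ℝ] E3) {m i j : ℤ}
    (h : ‖A (((i : ℝ) • triangularVec₁ a) + ((j : ℝ) • triangularVec₂ a) +
      ((haggLabel s m : ℝ) • barlowOffset a) + (z m • layerNormal 1))‖ ≤ 4) :
    |m| ≤ 16 ∧ |i| ≤ 16 ∧ |j| ≤ 16 := by
  obtain ⟨ha0, ha1, hs, hz⟩ := hadm
  rw [A.norm_map] at h
  set q : E3 := ((i : ℝ) • triangularVec₁ a) + ((j : ℝ) • triangularVec₂ a) +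
      ((haggLabel s m : ℝ) • barlowOffset a) + (z m • layerNormal 1) with hq
  have hc : ∀ k, |q k| ≤ 4 := fun k =>
    le_trans (by rw [← Real.norm_eq_abs]; exact PiLp.norm_apply_le q k) h
  have hq2 : q 2 = z m := by
    simp [hq, triangularVec₁, triangularVec₂, barlowOffset, layerNormal]
  have hq1 : q 1 = (a * √3) * ((j : ℝ) / 2 + (haggLabel s m : ℝ) / 6) := by
    simp [hq, triangularVec₁, triangularVec₂, barlowOffset, layerNormal]; ring
  have hq0 : q 0 = a * ((i : ℝ) + (j : ℝ) / 2 + (haggLabel s m : ℝ) / 2) := by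
    simp [hq, triangularVec₁, triangularVec₂, barlowOffset, layerNormal]; ring
  have hm : |m| ≤ (7 : ℕ) := by
    refine ext_layer_bound (R := 3) (M := 7) (by linarith) ha1 hz ⟨by rw [hz0]; linarith, hz0.le⟩
      (by push_cast; linarith) ?_
    rw [← hq2]
    linarith [hc 2]
  have hL : |(haggLabel s m : ℝ)| ≤ 7 := by
    have h := (PeriodicWindowsSketch.shp_abs_haggLabel_sub_le hs 0 m).trans (by simpa using hm)
    exact_mod_cast (show |haggLabel s m| ≤ (7 : ℤ) by simpa using h)
  have h3 : (3 / 2 : ℝ) ≤ √3 := by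
    nlinarith [Real.sq_sqrt (show (0 : ℝ) ≤ 3 by norm_num), Real.sqrt_nonneg 3]
  obtain ⟨hL1, hL2⟩ := abs_le.1 hL
  have hj : |j| ≤ 8 := by
    have h1 := hc 1
    rw [hq1, abs_mul, abs_of_pos (by nlinarith)] at h1
    have hw : 141 / 100 * |(j : ℝ) / 2 + (haggLabel s m : ℝ) / 6| ≤ 4 :=
      le_trans (mul_le_mul_of_nonneg_right (by nlinarith) (abs_nonneg _)) h1
    obtain ⟨hw1, hw2⟩ := abs_le.1
      (show |(j : ℝ) / 2 + (haggLabel s m : ℝ) / 6| ≤ 400 / 141 by linarith)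
    have hj1 : j < 9 := by exact_mod_cast (by linarith : (j : ℝ) < 9)
    have hj2 : -9 < j := by exact_mod_cast (by linarith : (-9 : ℝ) < j)
    rw [abs_le]; omega
  have hi : |i| ≤ 16 := by
    have h0 := hc 0
    rw [hq0, abs_mul, abs_of_pos (by linarith : (0 : ℝ) < a)] at h0
    have hw : 47 / 50 * |(i : ℝ) + (j : ℝ) / 2 + (haggLabel s m : ℝ) / 2| ≤ 4 :=
      le_trans (mul_le_mul_of_nonneg_right ha0 (abs_nonneg _)) h0
    obtain ⟨hw1, hw2⟩ := abs_le.1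
      (show |(i : ℝ) + (j : ℝ) / 2 + (haggLabel s m : ℝ) / 2| ≤ 200 / 47 by linarith)
    obtain ⟨hj1, hj2⟩ := abs_le.1 hj
    have hj1' : (-8 : ℝ) ≤ j := by exact_mod_cast hj1
    have hj2' : (j : ℝ) ≤ 8 := by exact_mod_cast hj2
    have hi1 : i < 12 := by exact_mod_cast (by linarith : (i : ℝ) < 12)
    have hi2 : -12 < i := by exact_mod_cast (by linarith : (-12 : ℝ) < i)
    rw [abs_le]; omega
  exact ⟨by have := abs_le.1 hm; rw [abs_le]; omega, hi,
    by have := abs_le.1 hj; rw [abs_le]; omega⟩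

/-- **Re-indexing.** Re-centring admissible layering data at one of its pattern points `p₀`
(shifting the layer index, the in-plane indices and the heights) gives admissible data with
`z' 0 = 0` whose layered set is the translate by `-p₀` of the original one
(`ext_haggLabel_shift`). [folklore] -/
theorem reindex (A : E3 →ₗᵢ[ℝ] E3) {a : ℝ} {s : ℤ → ℤ} {z : ℤ → ℝ}
    (hadm : IsAdmissibleLayering a s z) {p₀ : E3} (hp₀ : p₀ ∈ layeredSet A a s z) :
    ∃ (s' : ℤ → ℤ) (z' : ℤ → ℝ), IsAdmissibleLayering a s' z' ∧ z' 0 = 0 ∧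
      (∀ p ∈ layeredSet A a s z, p - p₀ ∈ layeredSet A a s' z') ∧
      (∀ p' ∈ layeredSet A a s' z', p' + p₀ ∈ layeredSet A a s z) := by
  obtain ⟨m₀, i₀, j₀, rfl⟩ := hp₀
  obtain ⟨ha0, ha1, hs, hz⟩ := hadm
  have key : ∀ m i j : ℤ,
      A (((i : ℝ) • triangularVec₁ a) + ((j : ℝ) • triangularVec₂ a) +
        ((haggLabel (fun k => s (k + m₀)) m : ℝ) • barlowOffset a) +
        ((z (m + m₀) - z m₀) • layerNormal 1)) =
      A ((((i + i₀ : ℤ) : ℝ) • triangularVec₁ a) + (((j + j₀ : ℤ) : ℝ) • triangularVec₂ a) +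
        ((haggLabel s (m + m₀) : ℝ) • barlowOffset a) + (z (m + m₀) • layerNormal 1)) -
      A (((i₀ : ℝ) • triangularVec₁ a) + ((j₀ : ℝ) • triangularVec₂ a) +
        ((haggLabel s m₀ : ℝ) • barlowOffset a) + (z m₀ • layerNormal 1)) := by
    intro m i j
    rw [← A.map_sub, ext_haggLabel_shift]
    congr 1
    push_cast
    simp only [add_smul, sub_smul]
    abel
  refine ⟨fun k => s (k + m₀), fun k => z (k + m₀) - z m₀, ⟨ha0, ha1, fun k => hs (k + m₀),
    fun m => ?_⟩, by simp, ?_, ?_⟩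
  · dsimp only
    have := hz (m + m₀)
    rw [show m + m₀ + 1 = m + 1 + m₀ by ring] at this
    constructor <;> linarith [this.1, this.2]
  · rintro p ⟨m, i, j, rfl⟩
    refine ⟨m - m₀, i - i₀, j - j₀, ?_⟩
    dsimp only
    rw [key]
    simp only [sub_add_cancel]
  · rintro p' ⟨m, i, j, rfl⟩
    refine ⟨m + m₀, i + i₀, j + j₀, ?_⟩
    dsimp only
    rw [key, sub_add_cancel]

/-- **Normalised data.** If `0 ∈ S` and `S` is `η`-layered at `0` (radii `2`, `19/10`), there are
admissible data with `z 0 = 0` and a translation of norm `≤ η` realising the two-way `η`-match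
(re-index at the pattern point matched with `0`, `reindex`). [folklore] -/
theorem exists_normalised {S : Set E3} (h0 : (0 : E3) ∈ S) {η : ℝ}
    (h : LayeredAt 2 (19 / 10) η S 0) :
    ∃ (A : E3 →ₗᵢ[ℝ] E3) (t : E3) (a : ℝ) (s : ℤ → ℤ) (z : ℤ → ℝ),
      IsAdmissibleLayering a s z ∧ z 0 = 0 ∧ ‖t‖ ≤ η ∧
      (∀ x ∈ S, ‖x‖ ≤ 2 → ∃ p ∈ layeredSet A a s z, dist (x + t) p ≤ η) ∧
      (∀ p ∈ layeredSet A a s z, dist p t ≤ 19 / 10 → ∃ x ∈ S, dist (x + t) p ≤ η) := by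
  obtain ⟨A, t, a, s, z, hadm, hS, hL⟩ := h
  obtain ⟨p₀, hp₀, hd₀⟩ := hS 0 h0 (by simp)
  obtain ⟨s', z', hadm', hz0', h₁, h₂⟩ := reindex A hadm hp₀
  refine ⟨A, t - p₀, a, s', z', hadm', hz0', by simpa [dist_eq_norm] using hd₀,
    fun x hx hx2 => ?_, fun p' hp' hd => ?_⟩
  · obtain ⟨p, hp, hd⟩ := hS x hx (by rwa [dist_zero_right])
    refine ⟨p - p₀, h₁ p hp, ?_⟩
    rwa [dist_eq_norm, show x + (t - p₀) - (p - p₀) = x + t - p by abel, ← dist_eq_norm]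
  · obtain ⟨x, hx, hxd⟩ := hL (p' + p₀) (h₂ p' hp') (by
      rwa [zero_add, dist_eq_norm, show p' + p₀ - t = p' - (t - p₀) by abel, ← dist_eq_norm])
    exact ⟨x, hx, by rwa [dist_eq_norm, show x + (t - p₀) - p' = x + t - (p' + p₀) by abel,
      ← dist_eq_norm]⟩

/-- **The compact data space**: isometries `×` admissible layering data with `z 0 = 0`, as a
subset of `(E3 →L E3) × ℝ × (ℤ → ℤ) × (ℤ → ℝ)`; closed (closed conditions) inside a product of
compact sets (`ext_isCompact_isometries`, `[47/50, 1]`, `ext_isCompact_words`, and a product of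
intervals containing the heights by `ext_abs_height_le`). [folklore] -/
theorem isCompact_data : IsCompact {e : (E3 →L[ℝ] E3) × ℝ × (ℤ → ℤ) × (ℤ → ℝ) |
    (∀ v, ‖e.1 v‖ = ‖v‖) ∧ IsAdmissibleLayering e.2.1 e.2.2.1 e.2.2.2 ∧ e.2.2.2 0 = 0} := by
  have ha : Continuous fun e : (E3 →L[ℝ] E3) × ℝ × (ℤ → ℤ) × (ℤ → ℝ) => e.2.1 :=
    continuous_fst.comp continuous_snd
  have hs : ∀ i : ℤ, Continuous fun e : (E3 →L[ℝ] E3) × ℝ × (ℤ → ℤ) × (ℤ → ℝ) => e.2.2.1 i :=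
    fun i => (continuous_apply i).comp (continuous_fst.comp (continuous_snd.comp continuous_snd))
  have hz : ∀ m : ℤ, Continuous fun e : (E3 →L[ℝ] E3) × ℝ × (ℤ → ℤ) × (ℤ → ℝ) => e.2.2.2 m :=
    fun m => (continuous_apply m).comp (continuous_snd.comp (continuous_snd.comp continuous_snd))
  refine IsCompact.of_isClosed_subset (ext_isCompact_isometries.prod
    ((isCompact_Icc : IsCompact (Icc (47 / 50 : ℝ) 1)).prod (ext_isCompact_words.prod
      (isCompact_univ_pi fun m : ℤ => isCompact_closedBall (0 : ℝ) (((|m| : ℤ) : ℝ) + 1))))) ?_ ?_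
  · simp only [IsAdmissibleLayering, IsHaggSeq, setOf_and, setOf_forall]
    refine (isClosed_iInter fun v => isClosed_eq ((continuous_eval_const v).comp
      continuous_fst).norm continuous_const).inter (((isClosed_le continuous_const ha).inter
      ((isClosed_le ha continuous_const).inter ((isClosed_iInter fun i => ?_).inter
      (isClosed_iInter fun m => (isClosed_le (by fun_prop) (by fun_prop)).inter
      (isClosed_le (by fun_prop) (by fun_prop)))))).inter (isClosed_eq (hz 0) continuous_const))
    exact (isClosed_discrete {y : ℤ | y = 1 ∨ y = -1}).preimage (hs i)
  · rintro ⟨T, a, s, z⟩ ⟨hT, ⟨ha0, ha1, hs', hz'⟩, hz0⟩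
    dsimp only at hT ha0 ha1 hs' hz' hz0
    refine mk_mem_prod hT (mk_mem_prod ⟨ha0, ha1⟩ (mk_mem_prod
      (mem_univ_pi.2 fun i => by rcases hs' i with h | h <;> simp [h]) (mem_univ_pi.2 fun m => ?_)))
    rw [mem_closedBall_zero_iff, Real.norm_eq_abs]
    have := ext_abs_height_le hz' ⟨by rw [hz0]; linarith, hz0.le⟩ m
    have h0 : (0 : ℝ) ≤ ((|m| : ℤ) : ℝ) := by exact_mod_cast abs_nonneg m
    nlinarith

/-- A limit of points that are (frequently) within `ε_k → 0` of a `δ`-separated set `S` belongs to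
`S`: the approximating points of `S` are eventually all equal. [folklore] -/
theorem mem_of_separated {δ : ℝ} (hδ : 0 < δ) {S : Set E3}
    (hS : ∀ x ∈ S, ∀ y ∈ S, x ≠ y → δ ≤ dist x y) {g : ℕ → E3} {ε : ℕ → ℝ} {p : E3}
    (hg : Tendsto g atTop (𝓝 p)) (hε : Tendsto ε atTop (𝓝 0))
    (h : ∃ᶠ k in atTop, ∃ x ∈ S, dist x (g k) ≤ ε k) : p ∈ S := by
  have hev : ∀ r : ℝ, 0 < r → ∀ᶠ k in atTop, dist (g k) p < r ∧ ε k < r := fun r hr =>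
    ((Metric.tendsto_nhds.1 hg) r hr).and (hε.eventually (gt_mem_nhds hr))
  have hnear : ∀ r : ℝ, 0 < r → ∃ x ∈ S, dist x p < r := by
    intro r hr
    obtain ⟨k, ⟨x, hxS, hxd⟩, hk1, hk2⟩ :=
      (h.and_eventually (hev (r / 2) (by positivity))).exists
    exact ⟨x, hxS, by linarith [dist_triangle x (g k) p]⟩
  obtain ⟨x₀, hx₀S, hx₀⟩ := hnear (δ / 2) (by positivity)
  by_contra hp
  have hρ : 0 < dist x₀ p := dist_pos.2 fun h => hp (h ▸ hx₀S)
  obtain ⟨x₁, hx₁S, hx₁⟩ := hnear (min (δ / 2) (dist x₀ p)) (lt_min (by positivity) hρ)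
  have h1 : dist x₁ p < δ / 2 := lt_of_lt_of_le hx₁ (min_le_left _ _)
  have h2 : dist x₁ p < dist x₀ p := lt_of_lt_of_le hx₁ (min_le_right _ _)
  rcases eq_or_ne x₀ x₁ with rfl | hne
  · exact lt_irrefl _ h2
  · linarith [hS x₀ hx₀S x₁ hx₁S hne, dist_triangle_right x₀ x₁ p]

/-- **Exactification at the origin.** A `δ`-separated `S ∋ 0` which is `η`-layered at `0` (radii
`2`, `19/10`) for every `η > 0` is exactly layered at `0`: extract a convergent subsequence of the
normalised data at tolerances `1/(n+1)` in the compact data space and pass to the limit using the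
local finiteness of both sides. [folklore] -/
theorem exactLayeredAt_zero {δ : ℝ} (hδ : 0 < δ) {S : Set E3}
    (hsep : ∀ x ∈ S, ∀ y ∈ S, x ≠ y → δ ≤ dist x y) (h0 : (0 : E3) ∈ S)
    (hlay : ∀ η : ℝ, 0 < η → LayeredAt 2 (19 / 10) η S 0) : ExactLayeredAt S 0 := by
  -- Step 1: normalised data at tolerance `1/(n+1)`; Step 2: a convergent subsequence
  choose A t a s z hadm hz0 ht hS hL using
    fun n : ℕ => exists_normalised h0 (hlay (1 / ((n : ℝ) + 1)) Nat.one_div_pos_of_nat)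
  have hη1 : ∀ n : ℕ, 1 / ((n : ℝ) + 1) ≤ 1 := fun n => by
    rw [div_le_one (by positivity)]
    linarith [(Nat.cast_nonneg n : (0 : ℝ) ≤ n)]
  obtain ⟨⟨T₀, a₀, s₀, z₀⟩, ⟨hT₀, hadm₀, hz₀⟩, φ, hφ, hconv⟩ := isCompact_data.tendsto_subseq
    (x := fun n =>
      (((A n).toContinuousLinearMap, a n, s n, z n) : (E3 →L[ℝ] E3) × ℝ × (ℤ → ℤ) × (ℤ → ℝ)))
    fun n => ⟨fun v => (A n).norm_map v, hadm n, hz0 n⟩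
  dsimp only at hT₀ hadm₀ hz₀
  have hconv' : Tendsto (fun k => ((A (φ k)).toContinuousLinearMap, a (φ k), s (φ k), z (φ k)))
      atTop (𝓝 ((T₀, a₀, s₀, z₀) : (E3 →L[ℝ] E3) × ℝ × (ℤ → ℤ) × (ℤ → ℝ))) := hconv
  let A₀ : E3 →ₗᵢ[ℝ] E3 := ⟨(T₀ : E3 →ₗ[ℝ] E3), hT₀⟩
  have hη : Tendsto (fun k => 1 / ((φ k : ℝ) + 1)) atTop (𝓝 0) :=
    tendsto_one_div_add_atTop_nhds_zero_nat.comp hφ.tendsto_atTop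
  have hη2 : Tendsto (fun k => 2 * (1 / ((φ k : ℝ) + 1))) atTop (𝓝 0) := by
    have := hη.const_mul 2
    rwa [mul_zero] at this
  have htφ : Tendsto (fun k => t (φ k)) atTop (𝓝 0) :=
    tendsto_zero_iff_norm_tendsto_zero.2
      (squeeze_zero (fun _ => norm_nonneg _) (fun k => ht (φ k)) hη)
  have hlab := eventually_labels hconv' 16
  refine ⟨A₀, a₀, s₀, z₀, hadm₀, hz₀, fun x hx hx2 => ?_, ?_⟩
  · -- Step 3a: the `S`-side is exact
    rw [dist_zero_right] at hx2
    rw [sub_zero]; by_contra hxL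
    have hpart : ∀ n : ℕ, ∃ m i j : ℤ, (|m| ≤ 16 ∧ |i| ≤ 16 ∧ |j| ≤ 16) ∧
        dist x (A n (((i : ℝ) • triangularVec₁ (a n)) + ((j : ℝ) • triangularVec₂ (a n)) +
          ((haggLabel (s n) m : ℝ) • barlowOffset (a n)) + (z n m • layerNormal 1))) ≤
          2 * (1 / ((n : ℝ) + 1)) := by
      intro n
      obtain ⟨p, hp, hd⟩ := hS n x hx hx2
      have hp4 : ‖p‖ ≤ 4 := by
        have h1 : ‖x + t n‖ ≤ 3 := (norm_add_le _ _).trans (by linarith [ht n, hη1 n])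
        have h2 := dist_triangle_left p 0 (x + t n)
        rw [dist_zero_right, dist_zero_right] at h2
        linarith [hη1 n]
      have hxp : dist x p ≤ 2 * (1 / ((n : ℝ) + 1)) := by
        have h2 := dist_triangle x (x + t n) p
        rw [dist_self_add_right] at h2
        linarith [ht n]
      obtain ⟨m, i, j, rfl⟩ := hp
      exact ⟨m, i, j, index_bound (hadm n) (hz0 n) (A n) hp4, hxp⟩
    have hev : ∀ᶠ k in atTop, ∀ m ∈ Finset.Icc (-16 : ℤ) 16, ∀ i ∈ Finset.Icc (-16 : ℤ) 16,
        ∀ j ∈ Finset.Icc (-16 : ℤ) 16, 2 * (1 / ((φ k : ℝ) + 1)) <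
          dist x (A (φ k) (((i : ℝ) • triangularVec₁ (a (φ k))) +
            ((j : ℝ) • triangularVec₂ (a (φ k))) +
            ((haggLabel s₀ m : ℝ) • barlowOffset (a (φ k))) + (z (φ k) m • layerNormal 1))) := by
      refine (eventually_all_finset _).2 fun m _ => (eventually_all_finset _).2 fun i _ =>
        (eventually_all_finset _).2 fun j _ => hη2.eventually_lt
          (tendsto_const_nhds.dist (tendsto_point hconv' m i j (haggLabel s₀ m : ℝ)))
          (dist_pos.2 fun heq => ?_)
      exact hxL ⟨m, i, j, heq⟩
    obtain ⟨k, hk, hk'⟩ := (hev.and hlab).exists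
    obtain ⟨m, i, j, ⟨hm, hi, hj⟩, hd⟩ := hpart (φ k)
    rw [hk' m (by exact_mod_cast hm)] at hd
    have := hk m (Finset.mem_Icc.2 (abs_le.1 hm)) i (Finset.mem_Icc.2 (abs_le.1 hi)) j
      (Finset.mem_Icc.2 (abs_le.1 hj))
    exact absurd hd (not_le.2 this)
  · -- Step 3b: the pattern side is exact
    rintro p ⟨m, i, j, rfl⟩ hp
    rw [zero_add]
    have hm : |m| ≤ 16 := (index_bound hadm₀ hz₀ A₀ (hp.trans (by norm_num))).1
    have hP := tendsto_point hconv' m i j (haggLabel s₀ m : ℝ)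
    have hg := hP.sub htφ; rw [sub_zero] at hg
    refine mem_of_separated hδ hsep hg hη ?_
    have hev : ∀ᶠ k in atTop, dist (A (φ k) (((i : ℝ) • triangularVec₁ (a (φ k))) +
        ((j : ℝ) • triangularVec₂ (a (φ k))) + ((haggLabel s₀ m : ℝ) • barlowOffset (a (φ k))) +
        (z (φ k) m • layerNormal 1))) (t (φ k)) < 19 / 10 :=
      (hP.dist htφ).eventually_lt tendsto_const_nhds
        (by rw [dist_zero_right]; exact lt_of_le_of_lt hp (by norm_num))
    refine ((hev.and hlab).mono fun k hk => ?_).frequently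
    obtain ⟨hk, hk'⟩ := hk
    have key : ∀ q : E3, dist q (t (φ k)) < 19 / 10 →
        q ∈ layeredSet (A (φ k)) (a (φ k)) (s (φ k)) (z (φ k)) →
        ∃ x ∈ S, dist x (q - t (φ k)) ≤ 1 / ((φ k : ℝ) + 1) := fun q hq hqL => by
      obtain ⟨x, hxS, hxd⟩ := hL (φ k) q hqL hq.le
      exact ⟨x, hxS, by rwa [dist_sub_eq_dist_add_right]⟩
    exact key _ hk ⟨m, i, j, by rw [hk' m (by exact_mod_cast hm)]⟩

/-- **Stub `stub_exactify`** of the line `priced-floors-palm-exactification`: a point of a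
`δ`-separated configuration which is `η`-layered (radii `2`, `19/10`) for every `η > 0` is exactly
layered (reduce to the origin by translation covariance, `exactLayeredAt_zero`). [folklore] -/
theorem stub_exactify : ∀ δ : ℝ, 0 < δ → ∀ S : Set E3, (∀ x ∈ S, ∀ y ∈ S, x ≠ y → δ ≤ dist x y) → ∀ y ∈ S, (∀ η : ℝ, 0 < η → LayeredAt 2 (19 / 10) η S y) → ExactLayeredAt S y := by
  intro δ hδ S hsep y hy hlay
  have hsep' : ∀ x ∈ (fun z => z - y) '' S, ∀ x' ∈ (fun z => z - y) '' S, x ≠ x' →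
      δ ≤ dist x x' := by
    rintro _ ⟨x, hx, rfl⟩ _ ⟨x', hx', rfl⟩ hne
    rw [dist_sub_right]
    exact hsep x hx x' hx' fun h => hne (by rw [h])
  obtain ⟨A, a, s, z, hadm, hz0, h₁, h₂⟩ := exactLayeredAt_zero hδ hsep' ⟨y, hy, sub_self y⟩
    fun η hη => (layeredAt_image_sub_iff 2 (19 / 10) η S y).2 (hlay η hη)
  refine ⟨A, a, s, z, hadm, hz0, fun x hx hd => ?_, fun p hp hn => ?_⟩
  · simpa using h₁ (x - y) ⟨x, hx, rfl⟩ (by rwa [dist_zero_right, ← dist_eq_norm])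
  · obtain ⟨x, hx, hxe⟩ := h₂ p hp hn
    have hxe' : x - y = p := by simpa using hxe
    rw [show y + p = x by rw [← hxe']; abel]
    exact hx

end Summit.AtomisticToContinuum.Crystallization.Theorems.SlackRigidityPricedFloorsExactify

end
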